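import Mathlib
import Summits.BirchSwinnertonDyer.BirchSwinnertonDyer.Theses.ShadowIsolation
import Literature.NumberTheory.EllipticCurves.NewformAbelianVariety
import Literature.NumberTheory.EllipticCurves.BSDSha
import Literature.NumberTheory.EllipticCurves.RootNumber

/-!
# Sketch — crux idea `kato-repulsion-depth-certificate` for `PhantomShadow`
(crux-ideate round 1, ideator 2). First-lemma signatures only; nothing conjectural is proved here
(the one `theorem` is pure logic gluing two typed `Prop`s).
-/

namespace Summit.BirchSwinnertonDyer.BirchSwinnertonDyer.Cruxes.PhantomShadow.KatoRepulsion

open WeierstrassCurve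
open Literature.NumberTheory.EllipticCurves
open Literature.NumberTheory.EllipticCurves.ModularForms

/-- Two classes `σ₁ σ₂` of an additive group are `p^n`-independent: `σ₁` has exact order `p^n`,
`p^n` divides the order of `σ₂`, and any vanishing `ℤ`-combination has both coefficients divisible
by `p^n` (so the `p^n`-torsion rank of `⟨σ₁, σ₂⟩` is `2`). -/
def PnIndependent {A : Type*} [AddCommGroup A] (p n : ℕ) (σ₁ σ₂ : A) : Prop :=
  addOrderOf σ₁ = p ^ n ∧ p ^ n ∣ addOrderOf σ₂ ∧
    ∀ a b : ℤ, a • σ₁ + b • σ₂ = 0 → ((p ^ n : ℕ) : ℤ) ∣ a ∧ ((p ^ n : ℕ) : ℤ) ∣ b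

/-- **(L1) First lemma — the uniform `s_n ≥ 2` input.** Granting the Cassels–Tate pairing
(`exists_casselsTate_pairing`, tree fact bsd.S18), an element of EXACT order `p^n` in `Ш(W/ℚ)`
forces: either `Ш[p^∞]` has positive `ℤ_p`-corank, or `Ш[p^∞]` (then finite, with a nondegenerate
alternating pairing) contains two `p^n`-independent classes. Proof sketch (M-sized, provable now
from `ShaPrimaryModDivisibleSquare` / `finite_quot_and_isSquare_natCard_of_pairing`): in the
finite case the character `B(σ, ·)` has order `p^n`; pick `τ` with `B(σ, τ)` of order `p^n`; then
`aσ + bτ = 0 ⇒ p^n ∣ a, b` by pairing with `τ` and with `σ` (alternating). -/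
def TwoIndependentShaOfExactOrder : Prop :=
  ∀ (W : WeierstrassCurve ℚ) [W.IsElliptic] (p : ℕ) [Fact p.Prime] (n : ℕ), 1 ≤ n →
    WeierstrassCurve.exists_casselsTate_pairing (K := ℚ) →
    (∃ σ : W.sha, addOrderOf σ = p ^ n) →
      W.shaCorank p ≠ 0 ∨ ∃ σ₁ σ₂ : W.sha, PnIndependent p n σ₁ σ₂

/-- `M` is a product of SIGN-KEPT `n`-admissible primes for `(W, p)`: every prime `ℓ ∣ M` has
`ℓ ∤ p N_W`, `ℓ ≢ ±1 (mod p)` and `a_ℓ(W) ≡ −(ℓ+1) (mod p^n)` — the case in which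
`H¹(ℚ_ℓ, E[p^n]) = 0`, so level raising at `ℓ` neither flips the sign nor changes the Selmer group
(barrier note g12 on this item; Bertolini–Darmon 2005 §2). -/
def SignKeptLevel (W : WeierstrassCurve ℚ) [W.IsElliptic] [W.IsGloballyMinimal] (p n M : ℕ) : Prop :=
  Squarefree M ∧ Nat.Coprime M (p * W.conductorNorm ℤ) ∧
    ∀ ℓ : ℕ, ℓ.Prime → ℓ ∣ M →
      ¬ (p : ℤ) ∣ (ℓ : ℤ) - 1 ∧ ¬ (p : ℤ) ∣ (ℓ : ℤ) + 1 ∧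
        ((p : ℤ) ^ n) ∣ W.frobeniusTrace ℓ + ((ℓ : ℤ) + 1)

/-- The crux's congruence-and-shape clause for `g` at level `N_W · M` (verbatim from
`PhantomShadow`, minus the central-zero clause): new, normalised, `≠ f_W`, Fricke `w g = −g`,
strongly depth-`n` congruent at all `ℓ ∤ N_W M`. -/
def EvenCongruentAt (W : WeierstrassCurve ℚ) [W.IsElliptic] [W.IsGloballyMinimal] (p n M : ℕ)
    [NeZero (W.conductorNorm ℤ * M)]
    (g : CuspForm (CongruenceSubgroup.Gamma0 (W.conductorNorm ℤ * M)) 2) : Prop :=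
  ∃ (R : Subring ℂ) (φ : R →+* ZMod (p ^ n))
    (hR : ∀ ℓ : ℕ, ℓ.Prime → ¬ ℓ ∣ W.conductorNorm ℤ * M → heckeEigenvalue g ℓ ∈ R),
    IsNewform0 g ∧ (∃ m : ℕ, (UpperHalfPlane.qExpansion 1 ⇑g).coeff m ≠ ((W.LFunction m : ℤ) : ℂ)) ∧
    cuspHeckeOperatorₗ (CongruenceSubgroup.Gamma0 (W.conductorNorm ℤ * M)) 2
        (slToGLPos ModularGroup.S *
          diagGL ((W.conductorNorm ℤ * M : ℕ) : ℚ) 1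
            (Nat.cast_pos.mpr (NeZero.pos (W.conductorNorm ℤ * M))) one_pos) g = -g ∧
    ∀ (ℓ : ℕ) (hℓ : ℓ.Prime) (hℓL : ¬ ℓ ∣ W.conductorNorm ℤ * M),
      φ ⟨heckeEigenvalue g ℓ, hR ℓ hℓ hℓL⟩ = ((W.frobeniusTrace ℓ : ℤ) : ZMod (p ^ n))

/-- **(L2) KATO REPULSION, algebraic form (`Shadow⁻⁻`) — the provable residue of `PhantomShadow`.**
For an EVEN `W` (root number `+1`; for odd `W` one sign-flipping rank-RAISING prime is added, not
typed here), a positive corank of `Ш[p^∞]` and ANY sign-kept depth-`n` level-raised even `g`: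
either `A_g(ℚ)` is infinite (then `Λ(g,1) = 0` by Kato Cor. 14.3 — the live line's
`stub_katoFinite`, tree fact `kato_finite_mordellWeil_of_newformAbelianVariety`), or `Ш(A_g)`
contains two `p^n`-independent classes (indeed a copy of `Sel_{p^n}(W) ⊇ (ℤ/p^n)^{r+c}`,
`r + c ≥ 2` even by p-parity): Selmer identification `Sel_{𝔭^m}(A_g) = Sel_{p^m}(W)` (`m ≤ n`) +
`A_g(ℚ)[𝔭] = 0` (`E[p]` irreducible). With Kato's Euler-system divisibility for `g` this becomes
the L-VALUE DEPTH statement `ord_𝔭 L_alg(g,1) ≥ 2n − C(W,p)` (card text). In print modulo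
vendoring: Agashe–Stein 2002 Thm 3.1 (the direction points/Selmer of `W` ↦ `Ш(A_g)`), BD2005
§2–3 (admissible primes, local conditions), Pollack–Weston 2011 (depth-`n` lifting, periods). -/
def AbsorbedOrInfinite : Prop :=
  ∀ (W : WeierstrassCurve ℚ) [W.IsElliptic] [W.IsGloballyMinimal] (p : ℕ) [Fact p.Prime],
    5 ≤ p → W.HasGoodReductionAtPrime p → ¬ (p : ℤ) ∣ W.frobeniusTrace p →
    W.HasIrreducibleModPGaloisRep p → W.rootNumber = 1 → W.shaCorank p ≠ 0 →
    ∀ n : ℕ, 1 ≤ n → ∀ (M : ℕ) (_ : NeZero (W.conductorNorm ℤ * M))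
      (g : CuspForm (CongruenceSubgroup.Gamma0 (W.conductorNorm ℤ * M)) 2),
      SignKeptLevel W p n M → EvenCongruentAt W p n M g →
      ∀ D : NewformAbelianVariety g,
        Infinite (D.A.Points ℚ) ∨ ∃ σ₁ σ₂ : ↥D.sha, PnIndependent p n σ₁ σ₂

/-- **Sign-kept SUPPLY** (in print: Camporino–Pacetti 2018 Thm A/B for `p ≥ 7`, big image, with
the sign/`U_ℓ = −1` refinement NOT in print; Diamond–Taylor 1994; BD2005-type lifting at depth `n`).
For every depth there IS an even, sign-kept, strongly depth-`n` congruent newform. Recorded to make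
explicit that `PhantomShadow = SignKeptSupply ∧ SELECTION`, where SELECTION (= "some such `A_g` has
infinite Mordell–Weil", i.e. "is not absorbed") is the whole difficulty and — by the finite-depth
symmetry principle of the card — has no depth-`n` mechanism. -/
def SignKeptSupply : Prop :=
  ∀ (W : WeierstrassCurve ℚ) [W.IsElliptic] [W.IsGloballyMinimal] (p : ℕ) [Fact p.Prime],
    5 ≤ p → W.HasGoodReductionAtPrime p → ¬ (p : ℤ) ∣ W.frobeniusTrace p →
    W.HasIrreducibleModPGaloisRep p → W.rootNumber = 1 →
    ∀ n : ℕ, 1 ≤ n → ∃ (M : ℕ) (_ : NeZero (W.conductorNorm ℤ * M))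
      (g : CuspForm (CongruenceSubgroup.Gamma0 (W.conductorNorm ℤ * M)) 2),
      SignKeptLevel W p n M ∧ EvenCongruentAt W p n M g

/-- **The certificate form of the Ш-gap (`Isolation⁺`), rank-0 slice.** For large depth some
sign-kept even congruent `A_g` with finite Mordell–Weil group does NOT contain two
`p^n`-independent classes in `Ш(A_g)` (informally: `ord_𝔭 L_alg(g,1) < 2n − C`; general slice:
`< n (r_MW + 1) − C`, i.e. fewer than `r_MW + 2` independent classes). With `AbsorbedOrInfinite`
it yields `shaCorank = 0` for even rank-`0` `W` (`shaCorank_eq_zero_of_rankZero`); and it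
implies bounded exponent of `Ш(W)[p^∞]` in two lines (card: WHY the pair is a CERTIFICATE format
for Ш-finiteness, not an independent mechanism). -/
def ShallowShadowRankZero : Prop :=
  ∀ (W : WeierstrassCurve ℚ) [W.IsElliptic] [W.IsGloballyMinimal] (p : ℕ) [Fact p.Prime],
    5 ≤ p → W.HasGoodReductionAtPrime p → ¬ (p : ℤ) ∣ W.frobeniusTrace p →
    W.HasIrreducibleModPGaloisRep p → W.rootNumber = 1 → W.mordellWeilRank = 0 →
    ∃ n₀ : ℕ, ∀ n : ℕ, n₀ ≤ n → ∃ (M : ℕ) (_ : NeZero (W.conductorNorm ℤ * M))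
      (g : CuspForm (CongruenceSubgroup.Gamma0 (W.conductorNorm ℤ * M)) 2)
      (D : NewformAbelianVariety g),
      SignKeptLevel W p n M ∧ EvenCongruentAt W p n M g ∧ Finite (D.A.Points ℚ) ∧
        ¬ ∃ σ₁ σ₂ : ↥D.sha, PnIndependent p n σ₁ σ₂

/-- The two typed halves close the even rank-0 Ш-gap (the minimal phantom world `r = 0, c = 2`):
pure logic. -/
theorem shaCorank_eq_zero_of_rankZero (hA : AbsorbedOrInfinite) (hS : ShallowShadowRankZero)
    (W : WeierstrassCurve ℚ) [W.IsElliptic] [W.IsGloballyMinimal] (p : ℕ) [Fact p.Prime]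
    (h5 : 5 ≤ p) (hgood : W.HasGoodReductionAtPrime p) (hord : ¬ (p : ℤ) ∣ W.frobeniusTrace p)
    (hirr : W.HasIrreducibleModPGaloisRep p) (heven : W.rootNumber = 1)
    (hr : W.mordellWeilRank = 0) : W.shaCorank p = 0 := by
  by_contra hne
  obtain ⟨n₀, hn₀⟩ := hS W p h5 hgood hord hirr heven hr
  obtain ⟨M, hM, g, D, hsk, hcong, hfin, hno⟩ := hn₀ (max n₀ 1) (le_max_left _ _)
  rcases hA W p h5 hgood hord hirr heven hne (max n₀ 1) (le_max_right _ _) M hM g hsk hcong D with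
    hinf | habs
  · exact (not_finite_iff_infinite.mpr hinf) hfin
  · exact hno habs

end Summit.BirchSwinnertonDyer.BirchSwinnertonDyer.Cruxes.PhantomShadow.KatoRepulsion
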